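import Summits.QuantumFields.BalabanUV.T4Continuum.Support.NE9TiltedProduct

/-!
# NE9TiltedShell — the (SHELL) slice majorant of NE9-CUT for the FULL Gaussian structure of [II] (2.23):
# arbitrary covariance, quadratic tilt, LINEAR term, dominated prefactor

Cell `pub-balaban`, T4-DAG §2 node U3 / §6 NE9 (Lipschitz dependence of `E^{(j)}(X; g⃗, U)` on the COUPLING HISTORY, with
fading memory); lineage t4-ne9-p1 (analytic-dependence route), generation 19; census E26 / residual-ledger line (R-3c) of
`t4/T4-EST-NE9-P1.md` §26.

WHAT THIS CLOSES.  In the last-coupling two-point bound of the (2.14)-FORM activities (`NE9CouplingTwoPoint.norm_formAct_sub_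
formAct_le`, g18) the one channel without a counterpart in [Dimock2013]'s Lemma 22 is the CUT-OFF channel NE9-CUT: the small-field
characteristic functions `χ({|B(b)| < ε₁/g_k})` ([II] (1.34) p. 9, (2.3) p. 12) move with the varied coupling, and the displayed
binder (SHELL) asks for `∫_{S(s) Δ S(s′)} |integrand| ≤ σ·|s⁻¹ − s′⁻¹|`.  After Bałaban's own estimates (2.15)–(2.22) p. 15–16 the
fluctuation integral of one term of (2.14) has the form (2.23) p. 17:
`∫ dμ_{C^{(k)}(Z₀,0)}(B) · exp(−⟨B, Γ_k(Z₀,0)X⟩ + ½α₅‖B‖²) · (bounded remnants)` — a centred Gaussian of GENERAL (non-diagonal)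
covariance, a QUADRATIC tilt, a LINEAR term (mean shift by the outer variable `X`), a dominated prefactor.  `NE9GaussianSlice`
(g18) certified the slice majorant on the diagonal model and (2.24)'s determinant formula for any covariance; `NE9TiltedProduct`
(g19) completed the square with the linear term.  THIS MODULE proves the slice majorant for the full structure: writing the
covariance as `C = T²` (`T` symmetric, eigenvalues `t_i`, orthonormal eigenbasis `b_i`; the fluctuation field is `B = Tz`, `z`
standard Gaussian), for `0 ≤ α`, `αt_i² < 1`, any `h`, any bond functional `u` with `Tu ≠ 0`, and any measurable `G` with
`0 ≤ G(z) ≤ M·exp(½α‖Tz‖² + ⟨h, Tz⟩)`: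

  `∫ 1{a ≤ |⟨u, Tz⟩| < a′} G(z) d𝒩(z) ≤ M · Π_i (1 − αt_i²)^{−1/2} e^{(t_i⟨h,b_i⟩)²/(2(1 − αt_i²))} · 2(a′ − a)/√(2π‖Tu‖²)`

(`integral_shell_quadLinTilt_le`; `‖Tu‖² = ⟨u, Cu⟩ = C_{uu}` is the UNTILTED variance of the pinned bond variable, and the middle
factor is (2.24)'s `det(1 − αC)^{−1/2}` times `e^{½⟨h, C(1−αC)⁻¹h⟩}` in eigen-coordinates — EXACTLY the value of the same integral
without the shell indicator and with `G = M·exp(…)`).  Summed over the cut-off bonds of a polymer with the one-bond shells of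
`NE9CutoffShell.prodCutoff_symmDiff_subset` (§3, `integral_cutoffShell_quadLinTilt_le`):

  `∫ 1_{S(s) Δ S(s′)} G d𝒩 ≤ Σ_{b ∈ bonds} M · Π_i(…) · 2ε₁|s⁻¹ − s′⁻¹| / √(2π‖Tu_b‖²)`,

LINEAR in the threshold displacement `ε₁|s⁻¹ − s′⁻¹|` (hence a bounded modulus in `t = g⁻²`, `NE9CutoffShell.inv_sub_inv_le`).
So the (SHELL) slice majorant IS «(width of the shell)/√(2π C_{bb}) × the (2.23)→(2.26) majorant, summed over cut-off bonds» for
the full Gaussian structure of (2.23); what remains DISPLAYED for Bałaban's own terms is only the dictionary «the integrand of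
(2.23) is of this form» (his (2.15)–(2.22), PROOF-INTERIOR of (B)) and a lower bound on the diagonal of the conditioned fluctuation
covariance `C^{(k)}(Z₀,0)_{bb}` (elementary from the boundedness of its inverse `C*Δ^{(k)}C`, [I] (2.10)).

HONEST FRAMING (T4-DAG PAGE 1).  Rung (B)+1 on a FIXED finite torus with `FlowStep.BetaPertH` and (B) explicit — NOT infinite
volume, NOT a mass gap, NOT the Clay problem.  NE9 is a cell NEW ESTIMATE and is NOT discharged here; this module is elementary
Gaussian measure theory (`[folklore]`); [II] = [Balaban1988RG2Cluster] is quoted for TYPES only (ABSOLUTE RULE).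

§1 eigen-coordinates (`apply_sum_eigenvectorBasis`, `inner_apply_sum_eigenvectorBasis`, `norm_sq_apply_eq_sum`,
   `exp_quadLin_apply_sum_eq_tiltFun`, `norm_sq_le_tiltedVariance`);
§2 one pinned bond functional: `lintegral_shell_quadLinTilt_le` (ℝ≥0∞ form), **`integral_shell_quadLinTilt_le`**;
§3 the symmetric difference of the product cut-offs at two couplings: `lintegral_cutoffShell_quadLinTilt_le`,
   **`integral_cutoffShell_quadLinTilt_le`**.

References (TYPES only): [Balaban1988RG2Cluster] T. Bałaban, Renormalization group approach to lattice gauge field theories. II.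
Cluster expansions, CMP 116 (1988) 1–22: (1.34) p. 9, (2.3) p. 12, (2.14) p. 15, (2.23)–(2.26) p. 17.  [Dimock2013] J. Dimock,
The renormalization group according to Balaban. I, Rev. Math. Phys. 25 (2013), Lemma 22 (the template whose cut-off coupling is
fixed).
-/

noncomputable section

namespace Summit.QuantumFields.BalabanUV.T4Continuum.NE9TiltedShell

open MeasureTheory ProbabilityTheory Set NE9TiltedProduct
open scoped NNReal ENNReal BigOperators RealInnerProductSpace symmDiff

variable {E : Type*} [NormedAddCommGroup E] [InnerProductSpace ℝ E] [FiniteDimensional ℝ E] [MeasurableSpace E]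
  [BorelSpace E] {T : E →ₗ[ℝ] E} (hT : T.IsSymmetric) {n : ℕ} (hn : Module.finrank ℝ E = n)

/-! ## §1 Eigen-coordinates of the covariance square root -/

omit [MeasurableSpace E] [BorelSpace E] in
/-- In the orthonormal eigenbasis, `T(Σ_i w_i b_i) = Σ_i (t_i w_i) b_i`. [folklore] -/
theorem apply_sum_eigenvectorBasis (w : Fin n → ℝ) :
    T (∑ i, w i • hT.eigenvectorBasis hn i) = ∑ i, (hT.eigenvalues hn i * w i) • hT.eigenvectorBasis hn i := by
  rw [map_sum]
  refine Finset.sum_congr rfl fun i _ => ?_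
  rw [map_smul, hT.apply_eigenvectorBasis hn i, smul_smul]
  norm_num [mul_comm]

omit [MeasurableSpace E] [BorelSpace E] in
/-- In the orthonormal eigenbasis, `⟨v, T(Σ_i w_i b_i)⟩ = Σ_i (t_i⟨v, b_i⟩) w_i`. [folklore] -/
theorem inner_apply_sum_eigenvectorBasis (v : E) (w : Fin n → ℝ) :
    ⟪v, T (∑ i, w i • hT.eigenvectorBasis hn i)⟫ = ∑ i, (hT.eigenvalues hn i * ⟪v, hT.eigenvectorBasis hn i⟫) * w i := by
  rw [apply_sum_eigenvectorBasis hT hn w, inner_sum]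
  refine Finset.sum_congr rfl fun i _ => ?_
  rw [real_inner_smul_right]
  ring

omit [MeasurableSpace E] [BorelSpace E] in
/-- `‖Tu‖² = Σ_i (t_i⟨u, b_i⟩)²` — the UNTILTED variance of the bond functional `z ↦ ⟨u, Tz⟩` under the standard Gaussian
(`= ⟨u, T²u⟩ = C_{uu}`). [folklore] -/
theorem norm_sq_apply_eq_sum (u : E) :
    ‖T u‖ ^ 2 = ∑ i, (hT.eigenvalues hn i * ⟪u, hT.eigenvectorBasis hn i⟫) ^ 2 := by
  conv_lhs => rw [← (hT.eigenvectorBasis hn).sum_repr' u]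
  rw [NE9GaussianSlice.norm_sq_apply_sum_eigenvectorBasis hT hn]
  refine Finset.sum_congr rfl fun i _ => ?_
  rw [real_inner_comm]
  ring

omit [MeasurableSpace E] [BorelSpace E] in
/-- The quadratic-plus-linear exponent FACTORISES in eigen-coordinates into the product tilt of `NE9TiltedProduct`:
`exp(½α‖T(Σw_ib_i)‖² + ⟨h, T(Σw_ib_i)⟩) = Π_i exp(½(αt_i²)w_i² + (t_i⟨h,b_i⟩)w_i)`. [folklore] -/
theorem exp_quadLin_apply_sum_eq_tiltFun (α : ℝ) (h : E) (w : Fin n → ℝ) :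
    Real.exp (α / 2 * ‖T (∑ i, w i • hT.eigenvectorBasis hn i)‖ ^ 2 + ⟪h, T (∑ i, w i • hT.eigenvectorBasis hn i)⟫) =
      tiltFun (fun i => α * (hT.eigenvalues hn i) ^ 2)
        (fun i => hT.eigenvalues hn i * ⟪h, hT.eigenvectorBasis hn i⟫) w := by
  rw [NE9GaussianSlice.norm_sq_apply_sum_eigenvectorBasis hT hn w, inner_apply_sum_eigenvectorBasis hT hn h w,
    tiltFun, ← Real.exp_sum, Finset.mul_sum, ← Finset.sum_add_distrib]
  congr 1
  refine Finset.sum_congr rfl fun i _ => ?_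
  ring

omit [MeasurableSpace E] [BorelSpace E] in
/-- For `0 ≤ α` (and `αt_i² < 1`) the TILTED variance of the bond functional dominates the untilted one:
`‖Tu‖² ≤ Σ_i (t_i⟨u,b_i⟩)²(1 − αt_i²)⁻¹` (`= ⟨u, C(1 − αC)⁻¹u⟩`). [folklore] -/
theorem norm_sq_le_tiltedVariance {α : ℝ} (hα0 : 0 ≤ α) (hα : ∀ i, α * (hT.eigenvalues hn i) ^ 2 < 1) (u : E) :
    ‖T u‖ ^ 2 ≤ ∑ i, (hT.eigenvalues hn i * ⟪u, hT.eigenvectorBasis hn i⟫) ^ 2 * (1 - α * (hT.eigenvalues hn i) ^ 2)⁻¹ := by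
  rw [norm_sq_apply_eq_sum hT hn u]
  refine Finset.sum_le_sum fun i _ => ?_
  have h1 : 1 ≤ (1 - α * (hT.eigenvalues hn i) ^ 2)⁻¹ := by
    rw [one_le_inv_iff₀]
    exact ⟨by linarith [hα i], by nlinarith [sq_nonneg (hT.eigenvalues hn i)]⟩
  calc (hT.eigenvalues hn i * ⟪u, hT.eigenvectorBasis hn i⟫) ^ 2
      = (hT.eigenvalues hn i * ⟪u, hT.eigenvectorBasis hn i⟫) ^ 2 * 1 := (mul_one _).symm
    _ ≤ _ := mul_le_mul_of_nonneg_left h1 (sq_nonneg _)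

/-! ## §2 One pinned bond functional: the shell × tilt × linear term × dominated prefactor -/

/-- Measurability of the shell of a bond functional. [folklore] -/
theorem measurableSet_shell (u : E) (a a' : ℝ) : MeasurableSet {z : E | a ≤ |⟪u, T z⟫| ∧ |⟪u, T z⟫| < a'} := by
  have hm : Measurable fun z : E => ⟪u, T z⟫ :=
    (continuous_const.inner T.continuous_of_finiteDimensional).measurable
  exact hm (Literature.Analysis.Fourier.measurableSet_annulus a a')

/-- **THE SLICE MAJORANT, ℝ≥0∞ form.**  For `0 ≤ α`, `αt_i² < 1`, `Tu ≠ 0`, `a ≤ a′` and a measurable `G` with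
`0 ≤ G ≤ M·exp(½α‖Tz‖² + ⟨h,Tz⟩)`:
`∫⁻ 1{a ≤ |⟨u,Tz⟩| < a′}·G d𝒩 ≤ M · Π_i(1 − αt_i²)^{−1/2}e^{(t_i⟨h,b_i⟩)²/(2(1−αt_i²))} · 2(a′ − a)/√(2π‖Tu‖²)` — rotate to the
eigenbasis (`stdGaussian_eq_map_pi_orthonormalBasis`), factorise the exponent (`exp_quadLin_apply_sum_eq_tiltFun`), complete the
squares and take the Gaussian law of the bond functional (`NE9TiltedProduct.lintegral_shell_tiltFun_le`), and compare the tilted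
variance with `‖Tu‖²` (`norm_sq_le_tiltedVariance`). [cite: Balaban1988RG2Cluster, (2.23)-(2.24) p.17 and (2.3) p.12] -/
theorem lintegral_shell_quadLinTilt_le {α : ℝ} (hα0 : 0 ≤ α) (hα : ∀ i, α * (hT.eigenvalues hn i) ^ 2 < 1) (h u : E)
    (hu : T u ≠ 0) {a a' : ℝ} (haa' : a ≤ a') {G : E → ℝ} (hGm : Measurable G) {M : ℝ} (hM : 0 ≤ M)
    (hG : ∀ z, 0 ≤ G z ∧ G z ≤ M * Real.exp (α / 2 * ‖T z‖ ^ 2 + ⟪h, T z⟫)) :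
    ∫⁻ z, ENNReal.ofReal ({z : E | a ≤ |⟪u, T z⟫| ∧ |⟪u, T z⟫| < a'}.indicator G z) ∂(stdGaussian E) ≤
      ENNReal.ofReal M *
        (∏ i, (tiltConst (α * (hT.eigenvalues hn i) ^ 2) (hT.eigenvalues hn i * ⟪h, hT.eigenvectorBasis hn i⟫)).toNNReal) *
        ENNReal.ofReal (2 * (a' - a) * (Real.sqrt (2 * Real.pi * ‖T u‖ ^ 2))⁻¹) := by
  set b := hT.eigenvectorBasis hn with hb
  set β : Fin n → ℝ := fun i => α * (hT.eigenvalues hn i) ^ 2 with hβdef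
  set γ : Fin n → ℝ := fun i => hT.eigenvalues hn i * ⟪h, b i⟫ with hγdef
  set c : Fin n → ℝ := fun i => hT.eigenvalues hn i * ⟪u, b i⟫ with hcdef
  have hβ : ∀ i, β i < 1 := hα
  set S : Set E := {z : E | a ≤ |⟪u, T z⟫| ∧ |⟪u, T z⟫| < a'} with hS
  have hSm : MeasurableSet S := measurableSet_shell (T := T) u a a'
  have hGSm : Measurable fun z : E => ENNReal.ofReal (S.indicator G z) := (hGm.indicator hSm).ennreal_ofReal
  -- the tilted variance of the bond functional and its comparison with ‖Tu‖²
  have hTu : 0 < ‖T u‖ ^ 2 := by positivity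
  have hVge : ‖T u‖ ^ 2 ≤ ∑ i, c i ^ 2 * (1 - β i)⁻¹ := norm_sq_le_tiltedVariance hT hn hα0 hα u
  have hV : 0 < ∑ i, c i ^ 2 * (1 - β i)⁻¹ := hTu.trans_le hVge
  -- rotate to the eigenbasis
  rw [stdGaussian_eq_map_pi_orthonormalBasis b]
  have hφ : Measurable (fun x : Fin n → ℝ => ∑ i, x i • b i) := by fun_prop
  rw [lintegral_map hGSm hφ]
  -- pointwise domination by the shell of the linear functional times the product tilt
  have hpt : ∀ w : Fin n → ℝ, ENNReal.ofReal (S.indicator G (∑ i, w i • b i)) ≤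
      {w : Fin n → ℝ | a ≤ |∑ i, c i * w i| ∧ |∑ i, c i * w i| < a'}.indicator (fun _ => ENNReal.ofReal M) w *
        ENNReal.ofReal (tiltFun β γ w) := by
    intro w
    have hinner : ⟪u, T (∑ i, w i • b i)⟫ = ∑ i, c i * w i := inner_apply_sum_eigenvectorBasis hT hn u w
    by_cases hw : (∑ i, w i • b i) ∈ S
    · have hw' : w ∈ {w : Fin n → ℝ | a ≤ |∑ i, c i * w i| ∧ |∑ i, c i * w i| < a'} := by
        have hw2 := hw
        simp only [hS, Set.mem_setOf_eq, hinner] at hw2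
        exact hw2
      rw [indicator_of_mem hw, indicator_of_mem hw', ← ENNReal.ofReal_mul hM,
        ← exp_quadLin_apply_sum_eq_tiltFun hT hn α h w]
      exact ENNReal.ofReal_le_ofReal (hG _).2
    · rw [indicator_of_notMem hw, ENNReal.ofReal_zero]
      exact zero_le
  calc ∫⁻ w, ENNReal.ofReal (S.indicator G (∑ i, w i • b i)) ∂(Measure.pi fun _ : Fin n => gaussianReal 0 1)
      ≤ ∫⁻ w, {w : Fin n → ℝ | a ≤ |∑ i, c i * w i| ∧ |∑ i, c i * w i| < a'}.indicator (fun _ => ENNReal.ofReal M) w *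
          ENNReal.ofReal (tiltFun β γ w) ∂(Measure.pi fun _ : Fin n => gaussianReal 0 1) := lintegral_mono hpt
    _ ≤ ENNReal.ofReal M * (∏ i, (tiltConst (β i) (γ i)).toNNReal) *
          ENNReal.ofReal (2 * (a' - a) * (Real.sqrt (2 * Real.pi * ∑ i, c i ^ 2 * (1 - β i)⁻¹))⁻¹) :=
        lintegral_shell_tiltFun_le hβ γ c haa' hV M
    _ ≤ ENNReal.ofReal M * (∏ i, (tiltConst (β i) (γ i)).toNNReal) *
          ENNReal.ofReal (2 * (a' - a) * (Real.sqrt (2 * Real.pi * ‖T u‖ ^ 2))⁻¹) := by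
        have hinv : (Real.sqrt (2 * Real.pi * ∑ i, c i ^ 2 * (1 - β i)⁻¹))⁻¹ ≤
            (Real.sqrt (2 * Real.pi * ‖T u‖ ^ 2))⁻¹ :=
          inv_anti₀ (Real.sqrt_pos.2 (by positivity)) (Real.sqrt_le_sqrt (by nlinarith [Real.pi_pos]))
        have h2 : 2 * (a' - a) * (Real.sqrt (2 * Real.pi * ∑ i, c i ^ 2 * (1 - β i)⁻¹))⁻¹ ≤
            2 * (a' - a) * (Real.sqrt (2 * Real.pi * ‖T u‖ ^ 2))⁻¹ :=
          mul_le_mul_of_nonneg_left hinv (by linarith)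
        exact mul_le_mul' le_rfl (ENNReal.ofReal_le_ofReal h2)

/-- **THE (SHELL) SLICE MAJORANT FOR THE FULL GAUSSIAN STRUCTURE OF [II] (2.23)** (real form).  Let the fluctuation
covariance be `C = T²` (`T` symmetric with eigenvalues `t_i` and orthonormal eigenbasis `b_i`; fluctuation field `B = Tz`, `z`
standard Gaussian), `0 ≤ α` with `αt_i² < 1` (print's «α₅‖C^{(k)}(Z₀,0)‖ < ½» p. 17), `h` any vector (the linear term
`−⟨B, Γ_k X⟩` of (2.23)), `u` a bond functional with `Tu ≠ 0`, and `G` measurable with `0 ≤ G(z) ≤ M·exp(½α‖Tz‖² + ⟨h, Tz⟩)`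
(dominated prefactor: contour densities, remaining `|χ| ≤ 1`, a tilt restricted to `Z₀`).  Then for `a ≤ a′`
`∫ 1{a ≤ |⟨u, Tz⟩| < a′} G(z) d𝒩(z) ≤ M · Π_i (1 − αt_i²)^{−1/2}e^{(t_i⟨h,b_i⟩)²/(2(1−αt_i²))} · 2(a′ − a)/√(2π‖Tu‖²)`:
the value of the un-pinned integral ((2.24)'s `det(1 − αC)^{−1/2}` times the completed square of the linear term) multiplied by
(width of the shell)/√(2π C_{uu}).  LINEAR in the width. [cite: Balaban1988RG2Cluster, (2.23)-(2.26) p.17 and (2.3) p.12] -/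
theorem integral_shell_quadLinTilt_le {α : ℝ} (hα0 : 0 ≤ α) (hα : ∀ i, α * (hT.eigenvalues hn i) ^ 2 < 1) (h u : E)
    (hu : T u ≠ 0) {a a' : ℝ} (haa' : a ≤ a') {G : E → ℝ} (hGm : Measurable G) {M : ℝ} (hM : 0 ≤ M)
    (hG : ∀ z, 0 ≤ G z ∧ G z ≤ M * Real.exp (α / 2 * ‖T z‖ ^ 2 + ⟪h, T z⟫)) :
    ∫ z, {z : E | a ≤ |⟪u, T z⟫| ∧ |⟪u, T z⟫| < a'}.indicator G z ∂(stdGaussian E) ≤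
      M * (∏ i, tiltConst (α * (hT.eigenvalues hn i) ^ 2) (hT.eigenvalues hn i * ⟪h, hT.eigenvectorBasis hn i⟫)) *
        (2 * (a' - a) * (Real.sqrt (2 * Real.pi * ‖T u‖ ^ 2))⁻¹) := by
  set S : Set E := {z : E | a ≤ |⟪u, T z⟫| ∧ |⟪u, T z⟫| < a'} with hS
  have hSm : MeasurableSet S := measurableSet_shell (T := T) u a a'
  have hnn : 0 ≤ᵐ[stdGaussian E] fun z => S.indicator G z :=
    ae_of_all _ fun z => Set.indicator_nonneg (fun z _ => (hG z).1) z
  rw [integral_eq_lintegral_of_nonneg_ae hnn (hGm.indicator hSm).aestronglyMeasurable]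
  have hlin := lintegral_shell_quadLinTilt_le hT hn hα0 hα h u hu haa' hGm hM hG
  have hK : ∀ i, 0 ≤ tiltConst (α * (hT.eigenvalues hn i) ^ 2) (hT.eigenvalues hn i * ⟪h, hT.eigenvectorBasis hn i⟫) :=
    fun i => (tiltConst_pos (hα i) _).le
  have hB : 0 ≤ 2 * (a' - a) * (Real.sqrt (2 * Real.pi * ‖T u‖ ^ 2))⁻¹ := by
    have : 0 ≤ a' - a := sub_nonneg.2 haa'
    positivity
  have hne : ENNReal.ofReal M *
      (∏ i, (tiltConst (α * (hT.eigenvalues hn i) ^ 2) (hT.eigenvalues hn i * ⟪h, hT.eigenvectorBasis hn i⟫)).toNNReal) *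
      ENNReal.ofReal (2 * (a' - a) * (Real.sqrt (2 * Real.pi * ‖T u‖ ^ 2))⁻¹) ≠ ∞ :=
    ENNReal.mul_ne_top (ENNReal.mul_ne_top ENNReal.ofReal_ne_top ENNReal.coe_ne_top) ENNReal.ofReal_ne_top
  refine (ENNReal.toReal_mono hne hlin).trans (le_of_eq ?_)
  rw [ENNReal.toReal_mul, ENNReal.toReal_mul, ENNReal.toReal_ofReal hM, ENNReal.toReal_ofReal hB, ENNReal.coe_toReal,
    NNReal.coe_prod]
  congr 2
  exact Finset.prod_congr rfl fun i _ => Real.coe_toNNReal _ (hK i)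

/-! ## §3 The symmetric difference of the product cut-offs at two couplings (summing over the pinned bond) -/

/-- **ℝ≥0∞ form of §3.** For a finite set of cut-off bonds with bond functionals `u_b` (`Tu_b ≠ 0`), thresholds `ε₁/s`, `ε₁/s′`
(`ε₁ ≥ 0`, `s, s′ > 0`) and `G` as in §2: `∫⁻ 1_{S(s) Δ S(s′)} G d𝒩 ≤ Σ_b M·Π_i(…)·2ε₁|s⁻¹ − s′⁻¹|/√(2π‖Tu_b‖²)` — the symmetric
difference lies in the union of the one-bond shells (`NE9CutoffShell.prodCutoff_symmDiff_subset`), each of width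
`ε₁|s⁻¹ − s′⁻¹|` (`NE9CutoffShell.shellWidth_eq`), and §2 bounds each shell. [cite: Balaban1988RG2Cluster, (2.3) p.12 and (2.23) p.17] -/
theorem lintegral_cutoffShell_quadLinTilt_le {Bd : Type*} (bonds : Finset Bd) (ub : Bd → E) {α : ℝ} (hα0 : 0 ≤ α)
    (hα : ∀ i, α * (hT.eigenvalues hn i) ^ 2 < 1) (h : E) (hub : ∀ b ∈ bonds, T (ub b) ≠ 0) {ε₁ s s' : ℝ} (hε : 0 ≤ ε₁)
    (hs : 0 < s) (hs' : 0 < s') {G : E → ℝ} (hGm : Measurable G) {M : ℝ} (hM : 0 ≤ M)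
    (hG : ∀ z, 0 ≤ G z ∧ G z ≤ M * Real.exp (α / 2 * ‖T z‖ ^ 2 + ⟪h, T z⟫)) :
    ∫⁻ z, ENNReal.ofReal ((NE9CutoffShell.prodCutoff bonds (fun b (z : E) => ⟪ub b, T z⟫) ε₁ s ∆
        NE9CutoffShell.prodCutoff bonds (fun b (z : E) => ⟪ub b, T z⟫) ε₁ s').indicator G z) ∂(stdGaussian E) ≤
      ∑ b ∈ bonds, ENNReal.ofReal M *
        (∏ i, (tiltConst (α * (hT.eigenvalues hn i) ^ 2) (hT.eigenvalues hn i * ⟪h, hT.eigenvectorBasis hn i⟫)).toNNReal) *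
        ENNReal.ofReal (2 * (ε₁ * |s⁻¹ - s'⁻¹|) * (Real.sqrt (2 * Real.pi * ‖T (ub b)‖ ^ 2))⁻¹) := by
  set D : Set E := NE9CutoffShell.prodCutoff bonds (fun b (z : E) => ⟪ub b, T z⟫) ε₁ s ∆
    NE9CutoffShell.prodCutoff bonds (fun b (z : E) => ⟪ub b, T z⟫) ε₁ s' with hD
  set Sh : Bd → Set E := fun b => {z : E | ε₁ / max s s' ≤ |⟪ub b, T z⟫| ∧ |⟪ub b, T z⟫| < ε₁ / min s s'} with hSh
  have hsub : D ⊆ ⋃ b ∈ bonds, Sh b :=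
    NE9CutoffShell.prodCutoff_symmDiff_subset bonds (fun b (z : E) => ⟪ub b, T z⟫) hε hs hs'
  -- pointwise: the indicator of the symmetric difference is dominated by the sum of the shell indicators
  have hpt : ∀ z : E, ENNReal.ofReal (D.indicator G z) ≤ ∑ b ∈ bonds, ENNReal.ofReal ((Sh b).indicator G z) := by
    intro z
    by_cases hz : z ∈ D
    · obtain ⟨b₀, hb₀, hzb₀⟩ : ∃ b₀ ∈ bonds, z ∈ Sh b₀ := by
        have hz' := hsub hz
        simpa only [Set.mem_iUnion, exists_prop] using hz'
      rw [indicator_of_mem hz]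
      calc ENNReal.ofReal (G z) = ENNReal.ofReal ((Sh b₀).indicator G z) := by rw [indicator_of_mem hzb₀]
        _ ≤ ∑ b ∈ bonds, ENNReal.ofReal ((Sh b).indicator G z) :=
            Finset.single_le_sum (f := fun b => ENNReal.ofReal ((Sh b).indicator G z)) (fun b _ => zero_le) hb₀
    · rw [indicator_of_notMem hz, ENNReal.ofReal_zero]
      exact zero_le
  have hmeas : ∀ b ∈ bonds, AEMeasurable (fun z : E => ENNReal.ofReal ((Sh b).indicator G z)) (stdGaussian E) :=
    fun b _ => ((hGm.indicator (measurableSet_shell (T := T) (ub b) _ _)).ennreal_ofReal).aemeasurable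
  have hle : ε₁ / max s s' ≤ ε₁ / min s s' := div_le_div_of_nonneg_left hε (lt_min hs hs') min_le_max
  calc ∫⁻ z, ENNReal.ofReal (D.indicator G z) ∂(stdGaussian E)
      ≤ ∫⁻ z, ∑ b ∈ bonds, ENNReal.ofReal ((Sh b).indicator G z) ∂(stdGaussian E) := lintegral_mono hpt
    _ = ∑ b ∈ bonds, ∫⁻ z, ENNReal.ofReal ((Sh b).indicator G z) ∂(stdGaussian E) := lintegral_finsetSum' _ hmeas
    _ ≤ ∑ b ∈ bonds, ENNReal.ofReal M *
          (∏ i, (tiltConst (α * (hT.eigenvalues hn i) ^ 2) (hT.eigenvalues hn i * ⟪h, hT.eigenvectorBasis hn i⟫)).toNNReal) *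
          ENNReal.ofReal (2 * (ε₁ * |s⁻¹ - s'⁻¹|) * (Real.sqrt (2 * Real.pi * ‖T (ub b)‖ ^ 2))⁻¹) := by
        refine Finset.sum_le_sum fun b hb => ?_
        have h1 := lintegral_shell_quadLinTilt_le hT hn hα0 hα h (ub b) (hub b hb) hle hGm hM hG
        rwa [NE9CutoffShell.shellWidth_eq hs hs'] at h1

/-- **THE (SHELL) BINDER OF NE9-CUT FOR THE FULL GAUSSIAN STRUCTURE OF [II] (2.23)** (real form, summed over the pinned
bond).  With the fluctuation covariance `C = T²`, the tilt `0 ≤ α`, `αt_i² < 1`, the linear term `h`, a finite set of cut-off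
bonds with bond functionals `u_b` (`Tu_b ≠ 0`; in coordinates `u_b = e_b`, `‖Tu_b‖² = C_{bb}`), thresholds `ε₁/s` and `ε₁/s′`
at the two couplings, and any measurable `G` with `0 ≤ G ≤ M·exp(½α‖Tz‖² + ⟨h,Tz⟩)`:
`∫ 1_{S(s) Δ S(s′)}(Tz) G(z) d𝒩(z) ≤ Σ_{b ∈ bonds} M · Π_i(1 − αt_i²)^{−1/2}e^{(t_i⟨h,b_i⟩)²/(2(1−αt_i²))} · 2ε₁|s⁻¹ − s′⁻¹|/√(2π‖Tu_b‖²)`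
— (width)/√(2πC_{bb}) × the un-pinned tilted mass, summed over cut-off bonds; LINEAR in `ε₁|s⁻¹ − s′⁻¹|`.
[cite: Balaban1988RG2Cluster, (1.34) p.9, (2.3) p.12, (2.23)-(2.26) p.17] -/
theorem integral_cutoffShell_quadLinTilt_le {Bd : Type*} (bonds : Finset Bd) (ub : Bd → E) {α : ℝ} (hα0 : 0 ≤ α)
    (hα : ∀ i, α * (hT.eigenvalues hn i) ^ 2 < 1) (h : E) (hub : ∀ b ∈ bonds, T (ub b) ≠ 0) {ε₁ s s' : ℝ} (hε : 0 ≤ ε₁)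
    (hs : 0 < s) (hs' : 0 < s') {G : E → ℝ} (hGm : Measurable G) {M : ℝ} (hM : 0 ≤ M)
    (hG : ∀ z, 0 ≤ G z ∧ G z ≤ M * Real.exp (α / 2 * ‖T z‖ ^ 2 + ⟪h, T z⟫)) :
    ∫ z, (NE9CutoffShell.prodCutoff bonds (fun b (z : E) => ⟪ub b, T z⟫) ε₁ s ∆
        NE9CutoffShell.prodCutoff bonds (fun b (z : E) => ⟪ub b, T z⟫) ε₁ s').indicator G z ∂(stdGaussian E) ≤
      ∑ b ∈ bonds, M *
        (∏ i, tiltConst (α * (hT.eigenvalues hn i) ^ 2) (hT.eigenvalues hn i * ⟪h, hT.eigenvectorBasis hn i⟫)) *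
        (2 * (ε₁ * |s⁻¹ - s'⁻¹|) * (Real.sqrt (2 * Real.pi * ‖T (ub b)‖ ^ 2))⁻¹) := by
  set D : Set E := NE9CutoffShell.prodCutoff bonds (fun b (z : E) => ⟪ub b, T z⟫) ε₁ s ∆
    NE9CutoffShell.prodCutoff bonds (fun b (z : E) => ⟪ub b, T z⟫) ε₁ s' with hD
  have hDm : MeasurableSet D := by
    have hP : ∀ r : ℝ, MeasurableSet (NE9CutoffShell.prodCutoff bonds (fun b (z : E) => ⟪ub b, T z⟫) ε₁ r) := by
      intro r
      have : NE9CutoffShell.prodCutoff bonds (fun b (z : E) => ⟪ub b, T z⟫) ε₁ r =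
          ⋂ b ∈ bonds, {z : E | |⟪ub b, T z⟫| < ε₁ / r} := by
        ext z; simp [NE9CutoffShell.prodCutoff]
      rw [this]
      refine Finset.measurableSet_biInter _ fun b _ => ?_
      have hm : Measurable fun z : E => |⟪ub b, T z⟫| :=
        (continuous_const.inner T.continuous_of_finiteDimensional).measurable.abs
      exact hm measurableSet_Iio
    exact (hP s).symmDiff (hP s')
  have hnn : 0 ≤ᵐ[stdGaussian E] fun z => D.indicator G z :=
    ae_of_all _ fun z => Set.indicator_nonneg (fun z _ => (hG z).1) z
  rw [integral_eq_lintegral_of_nonneg_ae hnn (hGm.indicator hDm).aestronglyMeasurable]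
  have hlin := lintegral_cutoffShell_quadLinTilt_le hT hn bonds ub hα0 hα h hub hε hs hs' hGm hM hG
  have hK : ∀ i, 0 ≤ tiltConst (α * (hT.eigenvalues hn i) ^ 2) (hT.eigenvalues hn i * ⟪h, hT.eigenvectorBasis hn i⟫) :=
    fun i => (tiltConst_pos (hα i) _).le
  have hBb : ∀ b, 0 ≤ 2 * (ε₁ * |s⁻¹ - s'⁻¹|) * (Real.sqrt (2 * Real.pi * ‖T (ub b)‖ ^ 2))⁻¹ := fun b => by positivity
  have hne : ∑ b ∈ bonds, ENNReal.ofReal M *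
      (∏ i, (tiltConst (α * (hT.eigenvalues hn i) ^ 2) (hT.eigenvalues hn i * ⟪h, hT.eigenvectorBasis hn i⟫)).toNNReal) *
      ENNReal.ofReal (2 * (ε₁ * |s⁻¹ - s'⁻¹|) * (Real.sqrt (2 * Real.pi * ‖T (ub b)‖ ^ 2))⁻¹) ≠ ∞ :=
    ENNReal.sum_ne_top.2 fun b _ =>
      ENNReal.mul_ne_top (ENNReal.mul_ne_top ENNReal.ofReal_ne_top ENNReal.coe_ne_top) ENNReal.ofReal_ne_top
  refine (ENNReal.toReal_mono hne hlin).trans (le_of_eq ?_)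
  rw [ENNReal.toReal_sum fun b _ =>
    ENNReal.mul_ne_top (ENNReal.mul_ne_top ENNReal.ofReal_ne_top ENNReal.coe_ne_top) ENNReal.ofReal_ne_top]
  refine Finset.sum_congr rfl fun b _ => ?_
  rw [ENNReal.toReal_mul, ENNReal.toReal_mul, ENNReal.toReal_ofReal hM, ENNReal.toReal_ofReal (hBb b),
    ENNReal.coe_toReal, NNReal.coe_prod]
  congr 2
  exact Finset.prod_congr rfl fun i _ => Real.coe_toNNReal _ (hK i)

end Summit.QuantumFields.BalabanUV.T4Continuum.NE9TiltedShell

end
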